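import Literature.Computability.Cryptography.FixedPointLogarithm
import Literature.Computability.Complexity.CodeFPRat
import Literature.Computability.Complexity.CodeFPBudgets
import Literature.Computability.Complexity.CodeFPLists
import Literature.Computability.Complexity.CodeFPArith
import HarnessLib

/-!
# Fixed-point logarithms in the typed polynomial-time algebra `CodeFP`

Topic `Computability/Cryptography`; proof companion of `FixedPointLogarithm.lean` (the exact
rational approximations `logSeries`, `log2Approx`, `logNatApprox`, `logRatApprox`,
`sqrtShiftApprox`, `logQIApprox`, `dyRound` used by Hallgren's walk, `PrincipalCycleWalk.lean`).
Theorems only (no definitions, no named facts): each of these functions is computed on codes by a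
polynomial-time string function (`CodeFP`, `Complexity/CodeFP.lean`), with integers in the `intE`
format, rationals in `encodeRat`, and the PRECISION / ITERATION-COUNT arguments in UNARY (`unE`) —
the number of series terms and the binary exponent are loop counts. Everything is assembled from the
typed combinators (`ratSum` over a `map`ped `urange` for the series; `natLog2Min` with the budget
`1^{size n}` for the binary exponent; `natSqrt` for `⌊√(D·4ᵇ)⌋`; `intEDiv` for the floor in
`dyRound`), so no machine or growth estimate is written here.

## References

* S. Arora, B. Barak, *Computational Complexity: A Modern Approach*, CUP 2009, §1.3 (polynomial-time
  computable functions; closure under composition and bounded loops). [AroraBarak2009]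
* R. P. Brent, P. Zimmermann, *Modern Computer Arithmetic*, CUP (2010), §4.4. [BrentZimmermann2010]
-/

namespace Literature.Computability.Cryptography

namespace FixedPointLog

open Literature.Computability.Complexity Literature.Computability.Complexity.CodeFP
open Literature.Algebra.EuclideanLattices (encodeRat)

/-! ### Small helpers -/

/-- `(z, n) ↦ z`-style casts: a natural number as a rational. (as `PeriodFinding.ratOfNat'` of `CEstFP.lean`; a private copy — that file's Kitaev-sums imports are foreign here). [folklore] -/
private theorem ratOfNatC : CodeFP natE encodeRat (fun n => (n : ℚ)) :=
  (ratOfIntNat.comp (intOfNat.pair (const natE (1 : ℕ)))).congr fun n => by simp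

/-- An integer as a rational. (as `PeriodFinding.ratOfInt'` of `CEstFP.lean`; a private copy — that file's Kitaev-sums imports are foreign here). [folklore] -/
private theorem ratOfIntC : CodeFP intE encodeRat (fun z => (z : ℚ)) :=
  (ratOfIntNat.comp ((CodeFP.id intE).pair (const intE (1 : ℕ)))).congr fun z => by simp

/-- Subtraction of rationals. (as `PeriodFinding.ratSub'` of `CEstFP.lean`; a private copy — that file's Kitaev-sums imports are foreign here). [folklore] -/
private theorem ratSubC : CodeFP (pairE encodeRat encodeRat) encodeRat (fun p => p.1 - p.2) :=
  (ratAdd.comp ((fst _ _).pair (ratMul.comp ((const _ (-1 : ℚ)).pair (snd _ _))))).congr fun p => by ring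

/-- Absolute value of a rational (`|q| = |num|/den`). (as `PeriodFinding.ratAbs'` of `CEstFP.lean`; a private copy — that file's Kitaev-sums imports are foreign here). [folklore] -/
private theorem ratAbsC : CodeFP encodeRat encodeRat (fun q => |q|) := by
  have h := ratOfIntNat.comp ((intAbs.comp ratNumDen.fst').pair ratNumDen.snd')
  refine h.congr fun q => ?_
  show ((|q.num| : ℤ) : ℚ) / (q.den : ℚ) = |q|
  rw [Int.cast_abs, ← Nat.abs_cast q.den, ← abs_div, Rat.num_div_den]

/-- Powers of a rational with a unary exponent (as `PowerSeriesFP.ratPow` of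
`PolyTimeComputablePowerSeries.lean`; a private documented copy — that file's Mathlib analysis imports are foreign here). [folklore] -/
private theorem ratPowC : CodeFP (pairE encodeRat unE) encodeRat (fun p => p.1 ^ p.2) := by
  have hq : CodeFP (pairE encodeRat unE) (pairE intE natE) (fun p => (p.1.num, p.1.den)) :=
    ratNumDen.comp (fst _ _)
  have hk : CodeFP (pairE encodeRat unE) unE (fun p => p.2) := snd _ _
  have hn := intPow.comp (hq.fst'.pair hk)
  have hd := natPow.comp (hq.snd'.pair hk)
  have hfin := ratOfIntNat.comp (hn.pair hd)
  refine hfin.congr fun p => ?_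
  obtain ⟨q, k⟩ := p
  simp only
  push_cast
  rw [← div_pow, Rat.num_div_den]

/-- The unary length of the binary code of `n` (`= size n`), a loop budget `≥ log₂ n`. [folklore] -/
theorem sizeUnC : CodeFP natE unE (fun n => Nat.size n) :=
  (strLength.comp strOfNat).congr fun n => length_natE n

/-- `log₂ n < size n`-type bound: `min (size n) (log₂ n) = log₂ n`. [folklore] -/
theorem min_size_log (n : ℕ) : min (Nat.size n) (Nat.log 2 n) = Nat.log 2 n := by
  apply min_eq_right
  rcases Nat.eq_zero_or_pos n with rfl | hn
  · simp
  · exact (Nat.lt_size.mpr (Nat.pow_log_le_self 2 hn.ne')).le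

/-- The binary exponent `⌊log₂ n⌋` on codes (binary output). (Deliberate duplicate of
`Literature.Algebra.EuclideanLattices.Khot.natLog2`, `KhotParamsFP.lean`, whose Euclidean-lattice imports are foreign
to this file; kept public because the walk programs of `PrincipalCycleWalkFP.lean` use it.) [folklore] -/
theorem natLog2C : CodeFP natE natE (Nat.log 2) := by
  have hb : CodeFP natE (rawE unitE) (fun n => List.replicate (Nat.size n) ()) := (replicateUnit.comp sizeUnC :)
  have hfin := natLog2Min.comp ((CodeFP.id natE).pair hb)
  refine hfin.congr fun n => ?_
  simp only [id_eq, List.length_replicate]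
  exact min_size_log n

/-- The binary exponent in unary. [folklore] -/
theorem unLog2C : CodeFP natE unE (Nat.log 2) := by
  have hfin := unOfNatMin.comp (sizeUnC.pair natLog2C)
  refine hfin.congr fun n => ?_
  simp only
  rw [min_comm]; exact min_size_log n

/-! ### The series and the logarithms -/

/-- A list sum over `range n` is the `Finset` sum. [folklore] -/
theorem sum_map_range (f : ℕ → ℚ) (n : ℕ) : ((List.range n).map f).sum = ∑ i ∈ Finset.range n, f i := by
  induction n with
  | zero => simp
  | succ n ih => rw [List.range_succ, List.map_append, List.sum_append, ih, Finset.sum_range_succ]; simp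

/-- **`logSeries` on codes** (`x` rational, `n` unary): the sum of the mapped range. [cite: BrentZimmermann2010, §4.4] -/
theorem logSeriesC : CodeFP (pairE encodeRat unE) encodeRat (fun p => logSeries p.1 p.2) := by
  -- the term map with context `(x, n)`: `i ↦ x^{min n (i+1)} / (i+1)`
  let σE : ℚ × ℕ → List Bool := pairE encodeRat unE
  have hx : CodeFP (pairE σE natE) encodeRat (fun t => t.1.1) := (fst _ _).fst'
  have hn : CodeFP (pairE σE natE) unE (fun t => t.1.2) := (fst _ _).snd'
  have hi : CodeFP (pairE σE natE) natE (fun t => t.2) := snd _ _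
  have hi1 : CodeFP (pairE σE natE) natE (fun t => t.2 + 1) := (natAdd.comp (hi.pair (const _ (1 : ℕ))) :)
  have hk : CodeFP (pairE σE natE) unE (fun t => min (t.2 + 1) t.1.2) := (unOfNatMin.comp (hn.pair hi1) :)
  have hpow := ratPowC.comp (hx.pair hk)
  have hden := ratOfNatC.comp hi1
  have hterm : CodeFP (pairE σE natE) encodeRat (fun t => t.1.1 ^ min (t.2 + 1) t.1.2 / ((t.2 + 1 : ℕ) : ℚ)) :=
    (ratDiv.comp (hpow.pair hden) :)
  have hmap := map (σ := ℚ × ℕ) (eσ := σE) hterm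
  have hl : CodeFP σE (rawE natE) (fun p => List.range p.2) := urange.comp (snd _ _)
  have h := ratSum.comp (hmap.comp ((CodeFP.id σE).pair hl))
  refine h.congr fun p => ?_
  obtain ⟨x, n⟩ := p
  show ((List.range n).map (fun i => x ^ min (i + 1) n / ((i + 1 : ℕ) : ℚ))).sum = logSeries x n
  rw [logSeries, ← sum_map_range]
  congr 1
  refine List.map_congr_left fun i hi => ?_
  rw [List.mem_range] at hi
  rw [min_eq_left (Nat.succ_le_of_lt hi)]
  push_cast
  rfl

/-- `log2Approx` on codes (unary argument). [cite: BrentZimmermann2010, §4.4] -/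
theorem log2ApproxC : CodeFP unE encodeRat log2Approx :=
  (logSeriesC.comp ((const unE ((1 : ℚ) / 2)).pair (CodeFP.id unE))).congr fun _ => rfl

/-- **`logNatApprox` on codes** (`n` binary, precision `a` unary). [cite: BrentZimmermann2010, §4.4] -/
theorem logNatApproxC : CodeFP (pairE natE unE) encodeRat (fun p => logNatApprox p.1 p.2) := by
  have hn : CodeFP (pairE natE unE) natE (fun p => p.1) := fst _ _
  have ha : CodeFP (pairE natE unE) unE (fun p => p.2) := snd _ _
  have heU : CodeFP (pairE natE unE) unE (fun p => Nat.log 2 p.1) := (unLog2C.comp hn :)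
  have heN : CodeFP (pairE natE unE) natE (fun p => Nat.log 2 p.1) := (natLog2C.comp hn :)
  have hpow : CodeFP (pairE natE unE) natE (fun p => 2 ^ Nat.log 2 p.1) := (natPow.comp ((const _ (2 : ℕ)).pair heU) :)
  have hx : CodeFP (pairE natE unE) encodeRat (fun p => (((p.1 : ℤ) - (2 ^ Nat.log 2 p.1 : ℕ) : ℤ) : ℚ) / (p.1 : ℚ)) :=
    (ratOfIntNat.comp ((intSub.comp ((intOfNat.comp hn).pair (intOfNat.comp hpow))).pair hn) :)
  have ha1e : CodeFP (pairE natE unE) unE (fun p => p.2 + 1 + Nat.log 2 p.1) := (unAdd.comp ((unSucc.comp ha).pair heU) :)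
  have h2 := log2ApproxC.comp ha1e
  have heQ := ratOfNatC.comp heN
  have hs := logSeriesC.comp (hx.pair (unSucc.comp ha))
  have h := ratAdd.comp ((ratMul.comp (heQ.pair h2)).pair hs)
  refine h.congr fun p => ?_
  obtain ⟨n, a⟩ := p
  simp only [logNatApprox]
  push_cast
  ring_nf

/-- **`logRatApprox` on codes** (`q` rational, `a` unary). [folklore] -/
theorem logRatApproxC : CodeFP (pairE encodeRat unE) encodeRat (fun p => logRatApprox p.1 p.2) := by
  have hq : CodeFP (pairE encodeRat unE) (pairE intE natE) (fun p => (p.1.num, p.1.den)) := ratNumDen.comp (fst _ _)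
  have ha1 : CodeFP (pairE encodeRat unE) unE (fun p => p.2 + 1) := unSucc.comp (snd _ _)
  have h1 := logNatApproxC.comp ((intNatAbs.comp hq.fst').pair ha1)
  have h2 := logNatApproxC.comp (hq.snd'.pair ha1)
  have hfin := ratSubC.comp (h1.pair h2)
  exact hfin.congr fun p => rfl

/-- **`sqrtShiftApprox` on codes** (`D` binary, `P` integer, `b` unary). [folklore] -/
theorem sqrtShiftApproxC : CodeFP (pairE natE (pairE intE unE)) encodeRat
    (fun p => sqrtShiftApprox p.1 p.2.1 p.2.2) := by
  have hD : CodeFP (pairE natE (pairE intE unE)) natE (fun p => p.1) := fst _ _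
  have hP : CodeFP (pairE natE (pairE intE unE)) intE (fun p => p.2.1) := (snd _ _).fst'
  have hb : CodeFP (pairE natE (pairE intE unE)) unE (fun p => p.2.2) := (snd _ _).snd'
  have h4b : CodeFP (pairE natE (pairE intE unE)) natE (fun p => 4 ^ p.2.2) := (natPow.comp ((const _ (4 : ℕ)).pair hb) :)
  have h2b : CodeFP (pairE natE (pairE intE unE)) natE (fun p => 2 ^ p.2.2) := (natPow.comp ((const _ (2 : ℕ)).pair hb) :)
  have hs : CodeFP (pairE natE (pairE intE unE)) natE (fun p => Nat.sqrt (p.1 * 4 ^ p.2.2)) :=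
    (natSqrt.comp (natMul.comp (hD.pair h4b)) :)
  have hnum : CodeFP (pairE natE (pairE intE unE)) intE (fun p => p.2.1 * (2 ^ p.2.2 : ℕ) + (Nat.sqrt (p.1 * 4 ^ p.2.2) : ℕ)) :=
    (intAdd.comp ((intMul.comp (hP.pair (intOfNat.comp h2b))).pair (intOfNat.comp hs)) :)
  have hfin := ratOfIntNat.comp (hnum.pair h2b)
  refine hfin.congr fun p => ?_
  simp only [sqrtShiftApprox]
  push_cast
  ring_nf

/-- `sqrtPrec` on codes, in unary. [folklore] -/
theorem sqrtPrecC : CodeFP (pairE natE (pairE intE unE)) unE (fun p => sqrtPrec p.1 p.2.1 p.2.2) := by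
  have hD : CodeFP (pairE natE (pairE intE unE)) natE (fun p => p.1) := fst _ _
  have hP : CodeFP (pairE natE (pairE intE unE)) intE (fun p => p.2.1) := (snd _ _).fst'
  have ha : CodeFP (pairE natE (pairE intE unE)) unE (fun p => p.2.2) := (snd _ _).snd'
  have hs := sizeUnC.comp (natAdd.comp (hD.pair (intNatAbs.comp hP)))
  have h3 : CodeFP (pairE natE (pairE intE unE)) unE (fun p => p.2.2 + 1 + 1 + 1) :=
    (unSucc.comp (unSucc.comp (unSucc.comp ha)) :)
  have hfin := unAdd.comp (h3.pair hs)
  exact hfin.congr fun p => by show p.2.2 + 1 + 1 + 1 + Nat.size (p.1 + p.2.1.natAbs) = sqrtPrec p.1 p.2.1 p.2.2; unfold sqrtPrec; omega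

/-- **`logQIApprox` on codes** (`D` binary, `P, Q` integers, `a` unary). [cite: JacobsonWilliams2008, §11.1–§11.2] -/
theorem logQIApproxC : CodeFP (pairE natE (pairE intE (pairE intE unE))) encodeRat
    (fun p => logQIApprox p.1 p.2.1 p.2.2.1 p.2.2.2) := by
  let E : ℕ × ℤ × ℤ × ℕ → List Bool := pairE natE (pairE intE (pairE intE unE))
  have hD : CodeFP E natE (fun p => p.1) := fst _ _
  have hP : CodeFP E intE (fun p => p.2.1) := (snd _ _).fst'
  have hQ : CodeFP E intE (fun p => p.2.2.1) := (snd _ _).snd'.fst'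
  have ha : CodeFP E unE (fun p => p.2.2.2) := (snd _ _).snd'.snd'
  have hb : CodeFP E unE (fun p => sqrtPrec p.1 p.2.1 p.2.2.2) := (sqrtPrecC.comp (hD.pair (hP.pair ha)) :)
  have ht : CodeFP E encodeRat (fun p => sqrtShiftApprox p.1 p.2.1 (sqrtPrec p.1 p.2.1 p.2.2.2)) :=
    (sqrtShiftApproxC.comp (hD.pair (hP.pair hb)) :)
  have ha2 : CodeFP E unE (fun p => p.2.2.2 + 1 + 1) := (unSucc.comp (unSucc.comp ha) :)
  have h1 := logRatApproxC.comp ((ratAbsC.comp ht).pair ha2)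
  have h2 := logNatApproxC.comp ((intNatAbs.comp hQ).pair ha2)
  have hfin := ratSubC.comp (h1.pair h2)
  exact hfin.congr fun p => rfl

/-- **`dyRound` on codes** (`a` unary, `q` rational): `⌊q·2ᵃ⌋ = num(q·2ᵃ) / den(q·2ᵃ)`. [folklore] -/
theorem dyRoundC : CodeFP (pairE unE encodeRat) encodeRat (fun p => dyRound p.1 p.2) := by
  have ha : CodeFP (pairE unE encodeRat) unE (fun p => p.1) := fst _ _
  have hq : CodeFP (pairE unE encodeRat) encodeRat (fun p => p.2) := snd _ _
  have h2a : CodeFP (pairE unE encodeRat) natE (fun p => 2 ^ p.1) := (natPow.comp ((const _ (2 : ℕ)).pair ha) :)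
  have hr : CodeFP (pairE unE encodeRat) encodeRat (fun p => p.2 * ((2 ^ p.1 : ℕ) : ℚ)) :=
    (ratMul.comp (hq.pair (ratOfNatC.comp h2a)) :)
  have hnd := ratNumDen.comp hr
  have hfl : CodeFP (pairE unE encodeRat) intE (fun p => (p.2 * ((2 ^ p.1 : ℕ) : ℚ)).num / ((p.2 * ((2 ^ p.1 : ℕ) : ℚ)).den : ℤ)) :=
    (intEDiv.comp (hnd.fst'.pair (intOfNat.comp hnd.snd')) :)
  have hfin := ratOfIntNat.comp (hfl.pair h2a)
  refine hfin.congr fun p => ?_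
  obtain ⟨a, q⟩ := p
  simp only [dyRound]
  rw [← Rat.floor_intCast_div_natCast, Rat.num_div_den]
  push_cast
  rfl

end FixedPointLog

end Literature.Computability.Cryptography
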